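/-
Copyright (c) 2026. All rights reserved.
Released under Apache 2.0 license as described in the file LICENSE.
-/
import Literature.AlgebraicGeometry.ComplexMultiplication.HyperellipticJacobianLevelSixtySeparation
import Literature.AlgebraicGeometry.ComplexMultiplication.HyperellipticJacobianLevelTwelveJacobian
import HarnessLib

/-!
# The third exceptional level: `J_{60} ∼ X_3² × X_4³ × X_5² × X_{15}² × Y_{20}⁴ × Y_{60}⁴` and
# `End⁰(J_{60}) ≅ Mat₂(ℚ(ζ_3)) × Mat₃(ℚ(i)) × Mat₂(ℚ(ζ_5)) × Mat₂(ℚ(ζ_{15})) × Mat₄(ℚ(√−5)) × Mat₄(F_{60})`, of dimension `170`,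
# `dim J_{60} = 29`

Layer `Literature/AlgebraicGeometry/ComplexMultiplication`, namespace `…ComplexMultiplication.HyperellipticJacobian`; the sequel of
`HyperellipticJacobianLevelSixtySeparation` (F19: `X_d ⟂ Y_{60}` for every odd `d`, `X_{10}, X_{30} ⟂ Y_{60}`),
`HyperellipticJacobianQuadraticReflexSeparation` (F17: `X_6 ⟂ Y_{60}`), `HyperellipticJacobianLevelTwenty` (F16: the blocks of `J_{20}`),
`HyperellipticJacobianLevelTwelveJacobian` (F15: the blocks `X_3 ⊕ X_6`, `X_4 ⊕ X_{12}` of `J_{12}`), `HyperellipticJacobianCrossLevelOrthogonality`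
(F12) and `HyperellipticJacobianEndomorphismAlgebras` (F9: `End⁰(X_{20}) ≅ Mat₄(ℚ(√−5))`, `End⁰(X_{60}) ≅ Mat₄(F_{60})`).  THEOREMS ONLY (no
definition, no named fact, no `sorry`, no instance).

## The print

A. Gallese, H. Goodson, D. Lombardo, arXiv:2405.20394 [GalleseGoodsonLombardo2024] (held `paper:arxiv-2405.20394`, p0012, p0015): THM. 3.0 and
§3.5 LEMMA 14 with the sentence following it («Note that this lemma, combined with the last statement in Thm. 3.0, yields the geometric
endomorphism algebra of `J_m` for every `m`»).  For `m = 60` the divisors `d ∉ {1, 2}` are `3, 4, 5, 6, 10, 12, 15, 20, 30, 60`: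
`J_{60} ∼ X_3 × X_4 × X_5 × X_6 × X_{10} × X_{12} × X_{15} × X_{20} × X_{30} × X_{60}` with `X_6 ∼ X_3`, `X_{10} ∼ X_5`, `X_{30} ∼ X_{15}` (Thm. 3.0 (4)),
`X_{12} ∼ X_4²` (Thm. 3.0 (5) at `d = 12`, F14: `Y_{12} = X_4`), `X_{20} ∼ Y_{20}⁴`, `X_{60} ∼ Y_{60}⁴` (Thm. 3.0 (6)), so
`J_{60} ∼ X_3² × X_4³ × X_5² × X_{15}² × Y_{20}⁴ × Y_{60}⁴` and — the six blocks being pairwise orthogonal —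
`End⁰(J_{60}) ≅ Mat₂(ℚ(ζ_3)) × Mat₃(ℚ(ζ_4)) × Mat₂(ℚ(ζ_5)) × Mat₂(ℚ(ζ_{15})) × Mat₄(ℚ(√−5)) × Mat₄(F_{60})`, `F_{60}` the splitting field of
`x⁴ + 15x² + 45` (§3.4), of dimension `8 + 18 + 16 + 32 + 32 + 64 = 170`; `dim J_{60} = 2 + 3 + 4 + 8 + 4 + 8 = 29 = g(C_{60})`.
(Reading the printed recipe with `Y_4 = X_4` and `Y_{12}` as distinct simple factors would give `… × ℚ(i) × Mat₂(ℚ(i)) × …`, of dimension `162`.)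

## What is proved

* §1, four cross relations the earlier files left implicit (all «`Hom = 0` both ways, not isogenous either way», for all realisations):
  **`orthogonal_odd_of_not_dvd`**, **`orthogonal_twiceOdd_of_not_dvd`** — `X_d` (`d` odd `≥ 3`), resp. `X_{2n}` (`n` odd `≥ 3`), is orthogonal
  to EVERY CM abelian variety with CM by `ℚ(ζ_m)` (any type) as soon as `d ∤ m`, resp. `n ∤ m` (`ζ_d ∈ K*(Φ_d)`; a root of unity of odd
  order `d` in a subfield of `ℚ(ζ_m)` forces `d ∣ m`); **`orthogonal_fourDvd_sixty_of_totient_ne_eight`** (`Y_d ⟂ Y_{60}` for `4 ∣ d ≥ 8`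
  non-exceptional with `φ(d) ≠ 8`, so `Y_{12} ⟂ Y_{60}`: reflex degrees `φ(d)/2 ≠ 4`); **`orthogonal_twenty_sixty`** (`Y_{20} ⟂ Y_{60}`: `2 ≠ 4`).
* §2, **`nonempty_endAlgebra_odd_twiceOdd_algEquiv_matrix`**: `End⁰(X_n ⊕ X_{2n}) ≃ₐ[ℚ] Mat₂(ℚ(ζ_n))` for every odd `n ≥ 3` (Thm. 3.0 (4) + Lemma 14).
* §3, **`hom_eq_zero_blocks_sixty`**: the blocks `A₃ ⊕ A₆`, `A₄ ⊕ A₁₂`, `A₅ ⊕ A₁₀`, `A₁₅ ⊕ A₃₀`, `A₂₀`, `A₆₀` of the carrier are pairwise orthogonal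
  (thirty relations: §1 for the pairs of levels `(5 ∕ 10, 3 ∕ 6 ∕ 4 ∕ 12)`, `(15 ∕ 30, 3 ∕ 6 ∕ 4 ∕ 12 ∕ 5 ∕ 10 ∕ 20)`, `(3 ∕ 6, 20)`, `(12, 60)`, `(20, 60)`;
  F15 for `(3 ∕ 6, 4 ∕ 12)`; F12 ∕ F16 ∕ F17 ∕ F19 for the rest).
* §4, **`nonempty_endAlgebra_algEquiv_sixtyJacobian`**: `End⁰(J) ≃ₐ[ℚ] Mat₂(ℚ(ζ_3)) × (Mat₃(ℚ(ζ_4)) × (Mat₂(ℚ(ζ_5)) × (Mat₂(ℚ(ζ_{15})) ×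
  (Mat₄(ℚ(r₂₀)) × Mat₄(ℚ(r₆₀))))))`, `r₂₀ = ζ + ζ³ + ζ⁷ + ζ⁹` (`r₂₀² = −5`), `r₆₀ = ζ + ζ¹¹ + ζ¹⁹ + ζ²⁹` (`r₆₀⁴ + 15 r₆₀² + 45 = 0`), and
  **`finrank_endAlgebra_sixtyJacobian`** (`dim_ℚ = 170`, `dim J = 29`).

## Honest column ∕ NOT here

The curve `y² = x^{60} + 1` and the identification of its Jacobian with the carrier (the tree speaks of realisations of the lower-half types);
the flat carrier `⨁ ![A₃, A₄, A₅, A₆, A₁₀, A₁₂, A₁₅, A₂₀, A₃₀, A₆₀]` (a re-indexing away); `Y_d` vs `Y_{d′}` with `φ(d) = φ(d′)`, `d ≡ d′ (mod 8)`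
(conductor theory).  `HC_CM` is not touched.

## References

* [GalleseGoodsonLombardo2024] arXiv:2405.20394 — §3 Thm. 3.0, §3.5 Lemma 14 and the sentence following it, §3.4, §3.5 Prop. 13 (proof).
* [MumfordAV1970] D. Mumford — §19 Thm. 3 Cor. 1–2, p. 174.
* [Shimura1998] G. Shimura — §5.1 Prop. 3, Prop. 6, §8.3 Prop. 28, §8.4 Example (1).
* [MilneCM2006] J. S. Milne — Ch. I §1 Prop. 1.18 (c), §3 Prop. 3.13.
* [Washington1997] L. Washington — Ch. 2 (Ex. 2.3), Thm. 2.5.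

## Provenance

Cell `pub-hodgecm2` (COR-CM), KEPT Literature lane `lit-deligne-3` gen 52 (claim GGL24-LEVEL-SIXTY-JACOBIAN; count-neutral, own lane).
-/

noncomputable section

open CategoryTheory CategoryTheory.Limits NumberField Module

namespace Literature.AlgebraicGeometry.ComplexMultiplication

open Literature.AlgebraicGeometry.Motives
open Literature.AlgebraicGeometry.HodgeTheory (complexBetti)
open Literature.NumberTheory.ComplexMultiplication

namespace HyperellipticJacobian

open Literature.AlgebraicGeometry.Pohlmann1968 Literature.AlgebraicGeometry.Pohlmann1968.Cyclotomic

/-! ## §1 Four cross relations: `X_d, X_{2n} ⟂` anything with CM by `ℚ(ζ_m)`, `d ∤ m`; `Y_{12}, Y_{20} ⟂ Y_{60}` -/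

section NotDvd

variable {d : ℕ} [NeZero d] {K : Type} [Field K] [NumberField K] {Φ : CMType K}
  {A : AbelianVariety ℂ} {ι : 𝓞 K →+* End A} {θ : K →+* Module.End ℂ (complexBetti A.X 1)}
  (m : ℕ) [NeZero m] {K' : Type} [Field K'] [NumberField K'] {Φ' : CMType K'}
  {A' : AbelianVariety ℂ} {ι' : 𝓞 K' →+* End A'} {θ' : K' →+* Module.End ℂ (complexBetti A'.X 1)}
  {n : ℕ} [NeZero (2 * n)] {L : Type} [Field L] [NumberField L] [IsCyclotomicExtension {2 * n} ℚ L] {Ψ : CMType L}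
  {B : AbelianVariety ℂ} {ιB : 𝓞 L →+* End B} {θB : L →+* Module.End ℂ (complexBetti B.X 1)}

/-- **`X_d ⟂` every abelian variety with CM by `ℚ(ζ_m)` (any CM type) when `d` is odd and `d ∤ m`** — e.g. `X_5 ⟂ X_3, X_6, X_4, X_{12}`,
`X_{15} ⟂ X_5, X_{10}, X_{20}`: the reflex field `K*(Φ_d) = x(ℚ(ζ_d))` contains a primitive `d`-th root of unity (Prop. 13), while a root of
unity of odd order `d` in the reflex field of a type of `ℚ(ζ_m)` (a subfield of `ℚ(ζ_m)`) forces `d ∣ 2m`, `d ∣ m`.  `Hom = 0` both ways, not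
isogenous either way, for all realisations. [cite: GalleseGoodsonLombardo2024, §3 Thm. 3.0 (last statement) and §3.5 Prop. 13 (proof)]
[cite: MilneCM2006, Ch. I §1 Prop. 1.18 (c) and §3 Prop. 3.13] [cite: Washington1997, Ch. 2 (Ex. 2.3)] -/
theorem orthogonal_odd_of_not_dvd [IsCyclotomicExtension {d} ℚ K] [IsCyclotomicExtension {m} ℚ K'] (hd : Odd d) (hdm : ¬ d ∣ m)
    (hΦ : ∀ σ : K →+* ℂ, σ ∈ Φ.1 ↔ 2 * (expOf d K σ).val < d) (hA : IsCMTypeRealisation Φ A ι θ)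
    (hA' : IsCMTypeRealisation Φ' A' ι' θ') :
    (∀ u : A ⟶ A', u = 0) ∧ (∀ v : A' ⟶ A, v = 0) ∧
      ¬ AbelianVariety.IsIsogenous A A' ∧ ¬ AbelianVariety.IsIsogenous A' A :=
  hA.orthogonal_of_isPrimitiveRoot hA' (exists_isPrimitiveRoot_mem_traceField_odd hd Φ hΦ)
    fun _ hy => not_isPrimitiveRoot_of_mem_traceField_of_not_dvd m Φ' hy hd hdm

/-- **`X_{2n} ⟂` every abelian variety with CM by `ℚ(ζ_m)` (any CM type) when `n` is odd, `n ≥ 3` and `n ∤ m`** — e.g. `X_{10} ⟂ X_3, X_6, X_4,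
X_{12}`, `X_{30} ⟂ X_5, X_{10}, X_{20}` (`K*(Φ_{2n}) = x(ℚ(ζ_{2n}))` contains a primitive `n`-th root of unity).
[cite: GalleseGoodsonLombardo2024, §3 Thm. 3.0 (4), (last statement) and §3.5 Prop. 13 (proof)] [cite: MilneCM2006, Ch. I §1 Prop. 1.18 (c) and §3 Prop. 3.13]
[cite: Washington1997, Ch. 2 (Ex. 2.3)] -/
theorem orthogonal_twiceOdd_of_not_dvd [IsCyclotomicExtension {m} ℚ K'] (hn : Odd n) (h3 : 3 ≤ n) (hnm : ¬ n ∣ m)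
    (hΨ : ∀ σ : L →+* ℂ, σ ∈ Ψ.1 ↔ 2 * (expOf (2 * n) L σ).val < 2 * n) (hB : IsCMTypeRealisation Ψ B ιB θB)
    (hA' : IsCMTypeRealisation Φ' A' ι' θ') :
    (∀ u : B ⟶ A', u = 0) ∧ (∀ v : A' ⟶ B, v = 0) ∧
      ¬ AbelianVariety.IsIsogenous B A' ∧ ¬ AbelianVariety.IsIsogenous A' B := by
  haveI : NeZero n := ⟨by omega⟩
  exact hB.orthogonal_of_isPrimitiveRoot hA' (exists_isPrimitiveRoot_mem_traceField_twiceOdd hn h3 Ψ hΨ)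
    fun _ hy => not_isPrimitiveRoot_of_mem_traceField_of_not_dvd m Φ' hy hn hnm

/-- **`Y_d ⟂ Y_{60}` for `4 ∣ d ≥ 8`, `d ∉ {20, 24, 60}`, `φ(d) ≠ 8`** — in particular **`Y_{12} ⟂ Y_{60}`** (and `X_{12} ⟂ X_{60}`): the reflex
degrees are `φ(d)/2` (F10) and `[F_{60} : ℚ] = 4`. [cite: GalleseGoodsonLombardo2024, §3 Thm. 3.0 (last statement) and §3.4 (`F_{60}`)]
[cite: MilneCM2006, Ch. I §1 Prop. 1.18 (c) and §3 Prop. 3.13] -/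
theorem orthogonal_fourDvd_sixty_of_totient_ne_eight [IsCyclotomicExtension {d} ℚ K] [IsCyclotomicExtension {60} ℚ K'] (h4 : 4 ∣ d)
    (h8 : 8 ≤ d) (h20 : d ≠ 20) (h24 : d ≠ 24) (h60 : d ≠ 60) (hφ : Nat.totient d ≠ 8)
    (hΦ : ∀ σ : K →+* ℂ, σ ∈ Φ.1 ↔ 2 * (expOf d K σ).val < d) (hA : IsCMTypeRealisation Φ A ι θ)
    (hΦ' : ∀ σ : K' →+* ℂ, σ ∈ Φ'.1 ↔ 2 * (expOf 60 K' σ).val < 60) (hA' : IsCMTypeRealisation Φ' A' ι' θ') :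
    (∀ u : A ⟶ A', u = 0) ∧ (∀ v : A' ⟶ A, v = 0) ∧
      ¬ AbelianVariety.IsIsogenous A A' ∧ ¬ AbelianVariety.IsIsogenous A' A := by
  obtain ⟨x⟩ := (inferInstance : Nonempty (K' →+* ℂ))
  obtain ⟨-, -, hfr, -⟩ := traceField_sixty Φ' hΦ' x
  refine hA.orthogonal_of_finrank_traceField_ne hA' fun h => hφ ?_
  rw [← two_mul_finrank_traceField_of_four_dvd h4 h8 h20 h24 h60 Φ hΦ, h, hfr]

/-- **`Y_{20} ⟂ Y_{60}`** (and `X_{20} ⟂ X_{60}`): the reflex degrees are `[ℚ(√−5) : ℚ] = 2` and `[F_{60} : ℚ] = 4`.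
[cite: GalleseGoodsonLombardo2024, §3 Thm. 3.0 (last statement) and §3.4] [cite: MilneCM2006, Ch. I §1 Prop. 1.18 (c) and §3 Prop. 3.13] -/
theorem orthogonal_twenty_sixty [IsCyclotomicExtension {20} ℚ K] [IsCyclotomicExtension {60} ℚ K']
    (hΦ : ∀ σ : K →+* ℂ, σ ∈ Φ.1 ↔ 2 * (expOf 20 K σ).val < 20) (hA : IsCMTypeRealisation Φ A ι θ)
    (hΦ' : ∀ σ : K' →+* ℂ, σ ∈ Φ'.1 ↔ 2 * (expOf 60 K' σ).val < 60) (hA' : IsCMTypeRealisation Φ' A' ι' θ') :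
    (∀ u : A ⟶ A', u = 0) ∧ (∀ v : A' ⟶ A, v = 0) ∧
      ¬ AbelianVariety.IsIsogenous A A' ∧ ¬ AbelianVariety.IsIsogenous A' A := by
  obtain ⟨x⟩ := (inferInstance : Nonempty (K →+* ℂ))
  obtain ⟨x'⟩ := (inferInstance : Nonempty (K' →+* ℂ))
  obtain ⟨-, -, h2, -⟩ := traceField_twenty Φ hΦ x
  obtain ⟨-, -, h4, -⟩ := traceField_sixty Φ' hΦ' x'
  refine hA.orthogonal_of_finrank_traceField_ne hA' ?_
  rw [h2, h4]
  decide

end NotDvd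

/-! ## §2 The `ℚ(ζ_n)`-block `X_n ⊕ X_{2n} ∼ X_n²`: `End⁰ ≅ Mat₂(ℚ(ζ_n))`; bookkeeping for pairs -/

section PairBlock

variable {n : ℕ} [NeZero n] [NeZero (2 * n)] {K : Type} [Field K] [NumberField K] {Φ : CMType K}
  {A : AbelianVariety ℂ} {ι : 𝓞 K →+* End A} {θ : K →+* Module.End ℂ (complexBetti A.X 1)}
  {L : Type} [Field L] [NumberField L] [IsCyclotomicExtension {2 * n} ℚ L] {Ψ : CMType L}
  {B : AbelianVariety ℂ} {ιB : 𝓞 L →+* End B} {θB : L →+* Module.End ℂ (complexBetti B.X 1)}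

/-- **`End⁰(X_n ⊕ X_{2n}) ≃ₐ[ℚ] Mat₂(ℚ(ζ_n))`** for `n` odd `≥ 3` and all realisations `A` of `Φ_n`, `B` of `Φ_{2n}` (`B ∼ A`, Thm. 3.0 (4);
`End⁰(A ⊕ A) = Mat₂(End⁰ A)`; `End⁰(A) = ℚ(ζ_n)`, Lemma 14, first case). [cite: GalleseGoodsonLombardo2024, §3 Thm. 3.0 (4) and §3.5 Lemma 14]
[cite: MumfordAV1970, §19 Cor. 2 of Thm. 3 and p. 174] [cite: Shimura1998, §5.1 Prop. 3 (proof) and Prop. 6] -/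
theorem nonempty_endAlgebra_odd_twiceOdd_algEquiv_matrix [IsCyclotomicExtension {n} ℚ K] (hn : Odd n) (h3 : 3 ≤ n)
    (hΦ : ∀ σ : K →+* ℂ, σ ∈ Φ.1 ↔ 2 * (expOf n K σ).val < n) (hA : IsCMTypeRealisation Φ A ι θ)
    (hΨ : ∀ σ : L →+* ℂ, σ ∈ Ψ.1 ↔ 2 * (expOf (2 * n) L σ).val < 2 * n) (hB : IsCMTypeRealisation Ψ B ιB θB) :
    Nonempty ((⨁ fun j : Fin 2 => (![A, B] : Fin 2 → AbelianVariety ℂ) j).endAlgebra ≃ₐ[ℚ] Matrix (Fin 2) (Fin 2) K) := by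
  obtain ⟨f₁⟩ := (isIsogenous_biproduct_pair (isIsogenous_twiceOdd hn h3 hΨ hΦ hB hA)).nonempty_endAlgebra_algEquiv
  obtain ⟨f₂⟩ := nonempty_matrix_algEquiv_endAlgebra_biproduct_const A 2
  obtain ⟨f₃⟩ := nonempty_endAlgebra_algEquiv_odd hn Φ hΦ hA
  exact ⟨(f₁.trans f₂.symm).trans f₃.mapMatrix⟩

/-- `dim (X_n ⊕ X_{2n}) = φ(n)` (`n` odd `≥ 3`). [cite: GalleseGoodsonLombardo2024, §3 Thm. 3.0 («X_d has dimension φ(d)/2»)] -/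
theorem dim_pair_odd_twiceOdd [IsCyclotomicExtension {n} ℚ K] (hn : Odd n) (h3 : 3 ≤ n)
    (hΦ : ∀ σ : K →+* ℂ, σ ∈ Φ.1 ↔ 2 * (expOf n K σ).val < n) (hA : IsCMTypeRealisation Φ A ι θ)
    (hΨ : ∀ σ : L →+* ℂ, σ ∈ Ψ.1 ↔ 2 * (expOf (2 * n) L σ).val < 2 * n) (hB : IsCMTypeRealisation Ψ B ιB θB) :
    (⨁ fun j : Fin 2 => (![A, B] : Fin 2 → AbelianVariety ℂ) j).dim = Nat.totient n := by
  classical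
  obtain ⟨-, hA2⟩ := finrank_endAlgebra_odd hn Φ hΦ hA
  have hB2 : 2 * B.dim = Nat.totient n := by
    rw [← (isIsogenous_twiceOdd hn h3 hΨ hΦ hB hA).dim_eq] at hA2
    exact hA2
  rw [AbelianVariety.dim_biproduct, Fin.sum_univ_two]
  simp only [Matrix.cons_val_zero, Matrix.cons_val_one]
  omega

/-- A homomorphism INTO a pair block vanishes if its two components do. [cite: MumfordAV1970, §19 (p. 174)] -/
theorem hom_to_pair_eq_zero {P Q Z : AbelianVariety ℂ} (h0 : ∀ u : Z ⟶ P, u = 0) (h1 : ∀ u : Z ⟶ Q, u = 0)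
    (f : Z ⟶ ⨁ fun l : Fin 2 => (![P, Q] : Fin 2 → AbelianVariety ℂ) l) : f = 0 := by
  refine biproduct.hom_ext _ _ fun l => ?_
  rw [Limits.zero_comp]
  match l with
  | ⟨0, _⟩ => exact h0 _
  | ⟨1, _⟩ => exact h1 _

/-- A homomorphism OUT OF a pair block vanishes if its two components do. [cite: MumfordAV1970, §19 (p. 174)] -/
theorem hom_from_pair_eq_zero {P Q Z : AbelianVariety ℂ} (h0 : ∀ u : P ⟶ Z, u = 0) (h1 : ∀ u : Q ⟶ Z, u = 0)
    (f : (⨁ fun l : Fin 2 => (![P, Q] : Fin 2 → AbelianVariety ℂ) l) ⟶ Z) : f = 0 := by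
  refine biproduct.hom_ext' _ _ fun l => ?_
  rw [Limits.comp_zero]
  match l with
  | ⟨0, _⟩ => exact h0 _
  | ⟨1, _⟩ => exact h1 _

/-- A homomorphism between two pair blocks vanishes if its four components do. [cite: MumfordAV1970, §19 (p. 174)] -/
theorem hom_pair_pair_eq_zero {P Q R S : AbelianVariety ℂ} (hPR : ∀ u : P ⟶ R, u = 0) (hPS : ∀ u : P ⟶ S, u = 0)
    (hQR : ∀ u : Q ⟶ R, u = 0) (hQS : ∀ u : Q ⟶ S, u = 0)
    (f : (⨁ fun l : Fin 2 => (![P, Q] : Fin 2 → AbelianVariety ℂ) l) ⟶ ⨁ fun l : Fin 2 => (![R, S] : Fin 2 → AbelianVariety ℂ) l) :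
    f = 0 :=
  hom_from_pair_eq_zero (fun u => hom_to_pair_eq_zero hPR hPS u) (fun u => hom_to_pair_eq_zero hQR hQS u) f

end PairBlock

/-! ## §3 Orthogonal families by induction on the list of blocks; the six blocks of `J_{60}` are pairwise orthogonal -/

section VecCons

/-- **Orthogonality of a family `(X, F₀, …, F_{k−1})` from that of `(F_l)` and of `X` against each `F_l`**: if `Hom(X, F_l) = 0 = Hom(F_l, X)`
for all `l` and `Hom(F_i, F_j) = 0` for `i ≠ j`, then every homomorphism between two different members of `Matrix.vecCons X F` vanishes
(the bookkeeping behind «`Hom(∏ X_i, ∏ Y_j) = ⊕ Hom(X_i, Y_j)`»). [cite: MumfordAV1970, §19 Thm. 3 Cor. 2 and p. 174] -/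
theorem hom_eq_zero_vecCons {k : ℕ} {X : AbelianVariety ℂ} {F : Fin k → AbelianVariety ℂ}
    (hX : ∀ l, (∀ u : X ⟶ F l, u = 0) ∧ (∀ v : F l ⟶ X, v = 0)) (hF : ∀ i j : Fin k, i ≠ j → ∀ f : F i ⟶ F j, f = 0) :
    ∀ i j : Fin (k + 1), i ≠ j →
      ∀ f : (Matrix.vecCons X F : Fin (k + 1) → AbelianVariety ℂ) i ⟶ (Matrix.vecCons X F : Fin (k + 1) → AbelianVariety ℂ) j, f = 0 := by
  intro i
  refine Fin.cases (motive := fun i => ∀ j : Fin (k + 1), i ≠ j →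
    ∀ f : (Matrix.vecCons X F : Fin (k + 1) → AbelianVariety ℂ) i ⟶ (Matrix.vecCons X F : Fin (k + 1) → AbelianVariety ℂ) j, f = 0)
    ?_ (fun i' => ?_) i
  · intro j
    refine Fin.cases (motive := fun j : Fin (k + 1) => (0 : Fin (k + 1)) ≠ j →
      ∀ f : (Matrix.vecCons X F : Fin (k + 1) → AbelianVariety ℂ) 0 ⟶ (Matrix.vecCons X F : Fin (k + 1) → AbelianVariety ℂ) j, f = 0)
      ?_ (fun j' => ?_) j
    · intro h
      exact absurd rfl h
    · intro _ f
      exact (hX j').1 f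
  · intro j
    refine Fin.cases (motive := fun j : Fin (k + 1) => Fin.succ i' ≠ j →
      ∀ f : (Matrix.vecCons X F : Fin (k + 1) → AbelianVariety ℂ) i'.succ ⟶ (Matrix.vecCons X F : Fin (k + 1) → AbelianVariety ℂ) j,
        f = 0) ?_ (fun j' => ?_) j
    · intro _ f
      exact (hX i').2 f
    · intro h f
      exact hF i' j' (fun e => h (by rw [e])) f

/-- A family indexed by `Fin 1` is (vacuously) pairwise orthogonal. [cite: MumfordAV1970, §19 (p. 174)] -/
theorem hom_eq_zero_of_fin_one {F : Fin 1 → AbelianVariety ℂ} : ∀ i j : Fin 1, i ≠ j → ∀ f : F i ⟶ F j, f = 0 :=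
  fun i j h => absurd (Subsingleton.elim i j) h

end VecCons

section SixtyJacobian

variable {K₃ : Type} [Field K₃] [NumberField K₃] [IsCyclotomicExtension {3} ℚ K₃] {Φ₃ : CMType K₃}
  {A₃ : AbelianVariety ℂ} {ι₃ : 𝓞 K₃ →+* End A₃} {θ₃ : K₃ →+* Module.End ℂ (complexBetti A₃.X 1)}
  {L₃ : Type} [Field L₃] [NumberField L₃] [IsCyclotomicExtension {2 * 3} ℚ L₃] {Ψ₃ : CMType L₃}
  {A₆ : AbelianVariety ℂ} {ι₆ : 𝓞 L₃ →+* End A₆} {θ₆ : L₃ →+* Module.End ℂ (complexBetti A₆.X 1)}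
  {K₄ : Type} [Field K₄] [NumberField K₄] [IsCyclotomicExtension {4} ℚ K₄] {Φ₄ : CMType K₄}
  {A₄ : AbelianVariety ℂ} {ι₄ : 𝓞 K₄ →+* End A₄} {θ₄ : K₄ →+* Module.End ℂ (complexBetti A₄.X 1)}
  {K₁₂ : Type} [Field K₁₂] [NumberField K₁₂] [IsCyclotomicExtension {12} ℚ K₁₂] {Φ₁₂ : CMType K₁₂}
  {A₁₂ : AbelianVariety ℂ} {ι₁₂ : 𝓞 K₁₂ →+* End A₁₂} {θ₁₂ : K₁₂ →+* Module.End ℂ (complexBetti A₁₂.X 1)}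
  {K₅ : Type} [Field K₅] [NumberField K₅] [IsCyclotomicExtension {5} ℚ K₅] {Φ₅ : CMType K₅}
  {A₅ : AbelianVariety ℂ} {ι₅ : 𝓞 K₅ →+* End A₅} {θ₅ : K₅ →+* Module.End ℂ (complexBetti A₅.X 1)}
  {L₅ : Type} [Field L₅] [NumberField L₅] [IsCyclotomicExtension {2 * 5} ℚ L₅] {Ψ₅ : CMType L₅}
  {A₁₀ : AbelianVariety ℂ} {ι₁₀ : 𝓞 L₅ →+* End A₁₀} {θ₁₀ : L₅ →+* Module.End ℂ (complexBetti A₁₀.X 1)}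
  {K₁₅ : Type} [Field K₁₅] [NumberField K₁₅] [IsCyclotomicExtension {15} ℚ K₁₅] {Φ₁₅ : CMType K₁₅}
  {A₁₅ : AbelianVariety ℂ} {ι₁₅ : 𝓞 K₁₅ →+* End A₁₅} {θ₁₅ : K₁₅ →+* Module.End ℂ (complexBetti A₁₅.X 1)}
  {L₁₅ : Type} [Field L₁₅] [NumberField L₁₅] [IsCyclotomicExtension {2 * 15} ℚ L₁₅] {Ψ₁₅ : CMType L₁₅}
  {A₃₀ : AbelianVariety ℂ} {ι₃₀ : 𝓞 L₁₅ →+* End A₃₀} {θ₃₀ : L₁₅ →+* Module.End ℂ (complexBetti A₃₀.X 1)}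
  {K₂₀ : Type} [Field K₂₀] [NumberField K₂₀] [IsCyclotomicExtension {20} ℚ K₂₀] {Φ₂₀ : CMType K₂₀}
  {A₂₀ : AbelianVariety ℂ} {ι₂₀ : 𝓞 K₂₀ →+* End A₂₀} {θ₂₀ : K₂₀ →+* Module.End ℂ (complexBetti A₂₀.X 1)}
  {K₆₀ : Type} [Field K₆₀] [NumberField K₆₀] [IsCyclotomicExtension {60} ℚ K₆₀] {Φ₆₀ : CMType K₆₀}
  {A₆₀ : AbelianVariety ℂ} {ι₆₀ : 𝓞 K₆₀ →+* End A₆₀} {θ₆₀ : K₆₀ →+* Module.End ℂ (complexBetti A₆₀.X 1)}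

/-- **The blocks `X_3 ⊕ X_6`, `X_4 ⊕ X_{12}`, `X_5 ⊕ X_{10}`, `X_{15} ⊕ X_{30}`, `X_{20}`, `X_{60}` of `J_{60}` are pairwise orthogonal**: every
homomorphism between two different blocks of the carrier vanishes (thirty relations — §1: a root of unity of odd order `5` ∕ `15` ∕ `3` in the
source's reflex field and none in the target's for the level pairs `(5 ∕ 10, 3 ∕ 6 ∕ 4 ∕ 12)`, `(15 ∕ 30, 3 ∕ 6 ∕ 4 ∕ 12 ∕ 5 ∕ 10 ∕ 20)`, `(3 ∕ 6, 20)`,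
reflex degrees for `(12, 60)`, `(20, 60)`; F15 for `(3 ∕ 6, 4 ∕ 12)`; F12 `(4, 60)`, `(5 ∕ 10, 20)`; F16 `(4 ∕ 12, 20)`; F17 `(6, 60)`; F19 `(3, 60)`,
`(5 ∕ 10 ∕ 15 ∕ 30, 60)`). [cite: GalleseGoodsonLombardo2024, §3 Thm. 3.0 (last statement) and §3.4] [cite: MilneCM2006, Ch. I §3 Prop. 3.13] -/
theorem hom_eq_zero_blocks_sixty (hΦ₃ : ∀ σ : K₃ →+* ℂ, σ ∈ Φ₃.1 ↔ 2 * (expOf 3 K₃ σ).val < 3)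
    (hA₃ : IsCMTypeRealisation Φ₃ A₃ ι₃ θ₃)
    (hΨ₃ : ∀ σ : L₃ →+* ℂ, σ ∈ Ψ₃.1 ↔ 2 * (expOf (2 * 3) L₃ σ).val < 2 * 3) (hA₆ : IsCMTypeRealisation Ψ₃ A₆ ι₆ θ₆)
    (hA₄ : IsCMTypeRealisation Φ₄ A₄ ι₄ θ₄)
    (hΦ₁₂ : ∀ σ : K₁₂ →+* ℂ, σ ∈ Φ₁₂.1 ↔ 2 * (expOf 12 K₁₂ σ).val < 12) (hA₁₂ : IsCMTypeRealisation Φ₁₂ A₁₂ ι₁₂ θ₁₂)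
    (hΦ₅ : ∀ σ : K₅ →+* ℂ, σ ∈ Φ₅.1 ↔ 2 * (expOf 5 K₅ σ).val < 5) (hA₅ : IsCMTypeRealisation Φ₅ A₅ ι₅ θ₅)
    (hΨ₅ : ∀ σ : L₅ →+* ℂ, σ ∈ Ψ₅.1 ↔ 2 * (expOf (2 * 5) L₅ σ).val < 2 * 5) (hA₁₀ : IsCMTypeRealisation Ψ₅ A₁₀ ι₁₀ θ₁₀)
    (hΦ₁₅ : ∀ σ : K₁₅ →+* ℂ, σ ∈ Φ₁₅.1 ↔ 2 * (expOf 15 K₁₅ σ).val < 15) (hA₁₅ : IsCMTypeRealisation Φ₁₅ A₁₅ ι₁₅ θ₁₅)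
    (hΨ₁₅ : ∀ σ : L₁₅ →+* ℂ, σ ∈ Ψ₁₅.1 ↔ 2 * (expOf (2 * 15) L₁₅ σ).val < 2 * 15) (hA₃₀ : IsCMTypeRealisation Ψ₁₅ A₃₀ ι₃₀ θ₃₀)
    (hΦ₂₀ : ∀ σ : K₂₀ →+* ℂ, σ ∈ Φ₂₀.1 ↔ 2 * (expOf 20 K₂₀ σ).val < 20) (hA₂₀ : IsCMTypeRealisation Φ₂₀ A₂₀ ι₂₀ θ₂₀)
    (hΦ₆₀ : ∀ σ : K₆₀ →+* ℂ, σ ∈ Φ₆₀.1 ↔ 2 * (expOf 60 K₆₀ σ).val < 60) (hA₆₀ : IsCMTypeRealisation Φ₆₀ A₆₀ ι₆₀ θ₆₀) :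
    ∀ i j : Fin 6, i ≠ j →
      ∀ f : (![⨁ fun l : Fin 2 => (![A₃, A₆] : Fin 2 → AbelianVariety ℂ) l, ⨁ fun l : Fin 2 => (![A₄, A₁₂] : Fin 2 → AbelianVariety ℂ) l,
          ⨁ fun l : Fin 2 => (![A₅, A₁₀] : Fin 2 → AbelianVariety ℂ) l, ⨁ fun l : Fin 2 => (![A₁₅, A₃₀] : Fin 2 → AbelianVariety ℂ) l,
          A₂₀, A₆₀] : Fin 6 → AbelianVariety ℂ) i ⟶
        (![⨁ fun l : Fin 2 => (![A₃, A₆] : Fin 2 → AbelianVariety ℂ) l, ⨁ fun l : Fin 2 => (![A₄, A₁₂] : Fin 2 → AbelianVariety ℂ) l,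
          ⨁ fun l : Fin 2 => (![A₅, A₁₀] : Fin 2 → AbelianVariety ℂ) l, ⨁ fun l : Fin 2 => (![A₁₅, A₃₀] : Fin 2 → AbelianVariety ℂ) l,
          A₂₀, A₆₀] : Fin 6 → AbelianVariety ℂ) j, f = 0 := by
  haveI : NeZero (2 * 3 : ℕ) := ⟨by norm_num⟩
  haveI : NeZero (2 * 5 : ℕ) := ⟨by norm_num⟩
  haveI : NeZero (2 * 15 : ℕ) := ⟨by norm_num⟩
  have hodd3 : Odd 3 := by decide
  have hodd5 : Odd 5 := by decide
  have hodd15 : Odd 15 := by decide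
  have h35 : 3 ≤ 5 := by norm_num
  have h315 : 3 ≤ 15 := by norm_num
  -- (0,1): F15
  have h01 := hom_eq_zero_blocks_twelve hΦ₃ hA₃ hΨ₃ hA₆ hA₄ hΦ₁₂ hA₁₂
  -- source `X_5 ∕ X_{10}` (a primitive fifth root of unity in `K*`), targets of levels `3, 6, 4, 12`
  have o5_3 := orthogonal_odd_of_not_dvd 3 hodd5 (by decide) hΦ₅ hA₅ hA₃
  have o5_6 := orthogonal_odd_of_not_dvd (2 * 3) hodd5 (by decide) hΦ₅ hA₅ hA₆
  have o5_4 := orthogonal_odd_of_not_dvd 4 hodd5 (by decide) hΦ₅ hA₅ hA₄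
  have o5_12 := orthogonal_odd_of_not_dvd 12 hodd5 (by decide) hΦ₅ hA₅ hA₁₂
  have o10_3 := orthogonal_twiceOdd_of_not_dvd 3 hodd5 h35 (by decide) hΨ₅ hA₁₀ hA₃
  have o10_6 := orthogonal_twiceOdd_of_not_dvd (2 * 3) hodd5 h35 (by decide) hΨ₅ hA₁₀ hA₆
  have o10_4 := orthogonal_twiceOdd_of_not_dvd 4 hodd5 h35 (by decide) hΨ₅ hA₁₀ hA₄
  have o10_12 := orthogonal_twiceOdd_of_not_dvd 12 hodd5 h35 (by decide) hΨ₅ hA₁₀ hA₁₂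
  -- source `X_{15} ∕ X_{30}` (a primitive fifteenth root of unity in `K*`), targets of levels `3, 6, 4, 12, 5, 10, 20`
  have o15_3 := orthogonal_odd_of_not_dvd 3 hodd15 (by decide) hΦ₁₅ hA₁₅ hA₃
  have o15_6 := orthogonal_odd_of_not_dvd (2 * 3) hodd15 (by decide) hΦ₁₅ hA₁₅ hA₆
  have o15_4 := orthogonal_odd_of_not_dvd 4 hodd15 (by decide) hΦ₁₅ hA₁₅ hA₄
  have o15_12 := orthogonal_odd_of_not_dvd 12 hodd15 (by decide) hΦ₁₅ hA₁₅ hA₁₂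
  have o15_5 := orthogonal_odd_of_not_dvd 5 hodd15 (by decide) hΦ₁₅ hA₁₅ hA₅
  have o15_10 := orthogonal_odd_of_not_dvd (2 * 5) hodd15 (by decide) hΦ₁₅ hA₁₅ hA₁₀
  have o15_20 := orthogonal_odd_of_not_dvd 20 hodd15 (by decide) hΦ₁₅ hA₁₅ hA₂₀
  have o30_3 := orthogonal_twiceOdd_of_not_dvd 3 hodd15 h315 (by decide) hΨ₁₅ hA₃₀ hA₃
  have o30_6 := orthogonal_twiceOdd_of_not_dvd (2 * 3) hodd15 h315 (by decide) hΨ₁₅ hA₃₀ hA₆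
  have o30_4 := orthogonal_twiceOdd_of_not_dvd 4 hodd15 h315 (by decide) hΨ₁₅ hA₃₀ hA₄
  have o30_12 := orthogonal_twiceOdd_of_not_dvd 12 hodd15 h315 (by decide) hΨ₁₅ hA₃₀ hA₁₂
  have o30_5 := orthogonal_twiceOdd_of_not_dvd 5 hodd15 h315 (by decide) hΨ₁₅ hA₃₀ hA₅
  have o30_10 := orthogonal_twiceOdd_of_not_dvd (2 * 5) hodd15 h315 (by decide) hΨ₁₅ hA₃₀ hA₁₀
  have o30_20 := orthogonal_twiceOdd_of_not_dvd 20 hodd15 h315 (by decide) hΨ₁₅ hA₃₀ hA₂₀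
  -- source `X_3 ∕ X_6` (a primitive cube root of unity in `K*`), target of level `20`
  have o3_20 := orthogonal_odd_of_not_dvd 20 hodd3 (by decide) hΦ₃ hA₃ hA₂₀
  have o6_20 := orthogonal_twiceOdd_of_not_dvd 20 hodd3 le_rfl (by decide) hΨ₃ hA₆ hA₂₀
  -- the level-`60` column (F19, F17, F12, §1) and the remaining level-`20` relations (F12, F16)
  have o3_60 := orthogonal_odd_sixty' hodd3 le_rfl hΦ₃ hA₃ hΦ₆₀ hA₆₀
  have o6_60 := orthogonal_twiceOdd_sixty_of_totient_ne_four hodd3 le_rfl (by decide +kernel) hΨ₃ hA₆ hΦ₆₀ hA₆₀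
  have o4_20 := orthogonal_four_twenty hA₄ hΦ₂₀ hA₂₀
  have o12_20 := orthogonal_fourDvd_twenty_of_not_eight_dvd ⟨3, rfl⟩ (by norm_num) (by norm_num) (by norm_num) (by decide)
    hΦ₁₂ hA₁₂ hΦ₂₀ hA₂₀
  have o4_60 := orthogonal_four_sixty hA₄ hΦ₆₀ hA₆₀
  have o12_60 := orthogonal_fourDvd_sixty_of_totient_ne_eight ⟨3, rfl⟩ (by norm_num) (by norm_num) (by norm_num) (by norm_num)
    (by decide +kernel) hΦ₁₂ hA₁₂ hΦ₆₀ hA₆₀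
  have o5_20 := orthogonal_odd_twenty hodd5 h35 hΦ₅ hA₅ hΦ₂₀ hA₂₀
  have o10_20 := orthogonal_twiceOdd_twenty hodd5 h35 hΨ₅ hA₁₀ hΦ₂₀ hA₂₀
  have o5_60 := orthogonal_odd_sixty_of_five_dvd hodd5 dvd_rfl hΦ₅ hA₅ hΦ₆₀ hA₆₀
  have o10_60 := orthogonal_twiceOdd_sixty_of_five_dvd hodd5 h35 dvd_rfl hΨ₅ hA₁₀ hΦ₆₀ hA₆₀
  have o15_60 := orthogonal_odd_sixty_of_five_dvd hodd15 ⟨3, rfl⟩ hΦ₁₅ hA₁₅ hΦ₆₀ hA₆₀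
  have o30_60 := orthogonal_twiceOdd_sixty_of_five_dvd hodd15 h315 ⟨3, rfl⟩ hΨ₁₅ hA₃₀ hΦ₆₀ hA₆₀
  have o20_60 := orthogonal_twenty_sixty hΦ₂₀ hA₂₀ hΦ₆₀ hA₆₀
  -- block-level relations, written «(Hom(B_i, B_j) = 0) ∧ (Hom(B_j, B_i) = 0)»
  have b01 : (∀ u : (⨁ fun l : Fin 2 => (![A₃, A₆] : Fin 2 → AbelianVariety ℂ) l) ⟶ (⨁ fun l : Fin 2 => (![A₄, A₁₂] : Fin 2 → AbelianVariety ℂ) l), u = 0) ∧ (∀ v : (⨁ fun l : Fin 2 => (![A₄, A₁₂] : Fin 2 → AbelianVariety ℂ) l) ⟶ (⨁ fun l : Fin 2 => (![A₃, A₆] : Fin 2 → AbelianVariety ℂ) l), v = 0) :=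
    ⟨fun u => h01 0 1 (by decide) u, fun v => h01 1 0 (by decide) v⟩
  have b02 : (∀ u : (⨁ fun l : Fin 2 => (![A₃, A₆] : Fin 2 → AbelianVariety ℂ) l) ⟶ (⨁ fun l : Fin 2 => (![A₅, A₁₀] : Fin 2 → AbelianVariety ℂ) l), u = 0) ∧ (∀ v : (⨁ fun l : Fin 2 => (![A₅, A₁₀] : Fin 2 → AbelianVariety ℂ) l) ⟶ (⨁ fun l : Fin 2 => (![A₃, A₆] : Fin 2 → AbelianVariety ℂ) l), v = 0) :=
    ⟨fun u => hom_pair_pair_eq_zero o5_3.2.1 o10_3.2.1 o5_6.2.1 o10_6.2.1 u,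
      fun v => hom_pair_pair_eq_zero o5_3.1 o5_6.1 o10_3.1 o10_6.1 v⟩
  have b03 : (∀ u : (⨁ fun l : Fin 2 => (![A₃, A₆] : Fin 2 → AbelianVariety ℂ) l) ⟶ (⨁ fun l : Fin 2 => (![A₁₅, A₃₀] : Fin 2 → AbelianVariety ℂ) l), u = 0) ∧ (∀ v : (⨁ fun l : Fin 2 => (![A₁₅, A₃₀] : Fin 2 → AbelianVariety ℂ) l) ⟶ (⨁ fun l : Fin 2 => (![A₃, A₆] : Fin 2 → AbelianVariety ℂ) l), v = 0) :=
    ⟨fun u => hom_pair_pair_eq_zero o15_3.2.1 o30_3.2.1 o15_6.2.1 o30_6.2.1 u,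
      fun v => hom_pair_pair_eq_zero o15_3.1 o15_6.1 o30_3.1 o30_6.1 v⟩
  have b04 : (∀ u : (⨁ fun l : Fin 2 => (![A₃, A₆] : Fin 2 → AbelianVariety ℂ) l) ⟶ A₂₀, u = 0) ∧ (∀ v : A₂₀ ⟶ (⨁ fun l : Fin 2 => (![A₃, A₆] : Fin 2 → AbelianVariety ℂ) l), v = 0) :=
    ⟨fun u => hom_from_pair_eq_zero o3_20.1 o6_20.1 u, fun v => hom_to_pair_eq_zero o3_20.2.1 o6_20.2.1 v⟩
  have b05 : (∀ u : (⨁ fun l : Fin 2 => (![A₃, A₆] : Fin 2 → AbelianVariety ℂ) l) ⟶ A₆₀, u = 0) ∧ (∀ v : A₆₀ ⟶ (⨁ fun l : Fin 2 => (![A₃, A₆] : Fin 2 → AbelianVariety ℂ) l), v = 0) :=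
    ⟨fun u => hom_from_pair_eq_zero o3_60.1 o6_60.1 u, fun v => hom_to_pair_eq_zero o3_60.2.1 o6_60.2.1 v⟩
  have b12 : (∀ u : (⨁ fun l : Fin 2 => (![A₄, A₁₂] : Fin 2 → AbelianVariety ℂ) l) ⟶ (⨁ fun l : Fin 2 => (![A₅, A₁₀] : Fin 2 → AbelianVariety ℂ) l), u = 0) ∧ (∀ v : (⨁ fun l : Fin 2 => (![A₅, A₁₀] : Fin 2 → AbelianVariety ℂ) l) ⟶ (⨁ fun l : Fin 2 => (![A₄, A₁₂] : Fin 2 → AbelianVariety ℂ) l), v = 0) :=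
    ⟨fun u => hom_pair_pair_eq_zero o5_4.2.1 o10_4.2.1 o5_12.2.1 o10_12.2.1 u,
      fun v => hom_pair_pair_eq_zero o5_4.1 o5_12.1 o10_4.1 o10_12.1 v⟩
  have b13 : (∀ u : (⨁ fun l : Fin 2 => (![A₄, A₁₂] : Fin 2 → AbelianVariety ℂ) l) ⟶ (⨁ fun l : Fin 2 => (![A₁₅, A₃₀] : Fin 2 → AbelianVariety ℂ) l), u = 0) ∧ (∀ v : (⨁ fun l : Fin 2 => (![A₁₅, A₃₀] : Fin 2 → AbelianVariety ℂ) l) ⟶ (⨁ fun l : Fin 2 => (![A₄, A₁₂] : Fin 2 → AbelianVariety ℂ) l), v = 0) :=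
    ⟨fun u => hom_pair_pair_eq_zero o15_4.2.1 o30_4.2.1 o15_12.2.1 o30_12.2.1 u,
      fun v => hom_pair_pair_eq_zero o15_4.1 o15_12.1 o30_4.1 o30_12.1 v⟩
  have b14 : (∀ u : (⨁ fun l : Fin 2 => (![A₄, A₁₂] : Fin 2 → AbelianVariety ℂ) l) ⟶ A₂₀, u = 0) ∧ (∀ v : A₂₀ ⟶ (⨁ fun l : Fin 2 => (![A₄, A₁₂] : Fin 2 → AbelianVariety ℂ) l), v = 0) :=
    ⟨fun u => hom_from_pair_eq_zero o4_20.1 o12_20.1 u, fun v => hom_to_pair_eq_zero o4_20.2.1 o12_20.2.1 v⟩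
  have b15 : (∀ u : (⨁ fun l : Fin 2 => (![A₄, A₁₂] : Fin 2 → AbelianVariety ℂ) l) ⟶ A₆₀, u = 0) ∧ (∀ v : A₆₀ ⟶ (⨁ fun l : Fin 2 => (![A₄, A₁₂] : Fin 2 → AbelianVariety ℂ) l), v = 0) :=
    ⟨fun u => hom_from_pair_eq_zero o4_60.1 o12_60.1 u, fun v => hom_to_pair_eq_zero o4_60.2.1 o12_60.2.1 v⟩
  have b23 : (∀ u : (⨁ fun l : Fin 2 => (![A₅, A₁₀] : Fin 2 → AbelianVariety ℂ) l) ⟶ (⨁ fun l : Fin 2 => (![A₁₅, A₃₀] : Fin 2 → AbelianVariety ℂ) l), u = 0) ∧ (∀ v : (⨁ fun l : Fin 2 => (![A₁₅, A₃₀] : Fin 2 → AbelianVariety ℂ) l) ⟶ (⨁ fun l : Fin 2 => (![A₅, A₁₀] : Fin 2 → AbelianVariety ℂ) l), v = 0) :=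
    ⟨fun u => hom_pair_pair_eq_zero o15_5.2.1 o30_5.2.1 o15_10.2.1 o30_10.2.1 u,
      fun v => hom_pair_pair_eq_zero o15_5.1 o15_10.1 o30_5.1 o30_10.1 v⟩
  have b24 : (∀ u : (⨁ fun l : Fin 2 => (![A₅, A₁₀] : Fin 2 → AbelianVariety ℂ) l) ⟶ A₂₀, u = 0) ∧ (∀ v : A₂₀ ⟶ (⨁ fun l : Fin 2 => (![A₅, A₁₀] : Fin 2 → AbelianVariety ℂ) l), v = 0) :=
    ⟨fun u => hom_from_pair_eq_zero o5_20.1 o10_20.1 u, fun v => hom_to_pair_eq_zero o5_20.2.1 o10_20.2.1 v⟩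
  have b25 : (∀ u : (⨁ fun l : Fin 2 => (![A₅, A₁₀] : Fin 2 → AbelianVariety ℂ) l) ⟶ A₆₀, u = 0) ∧ (∀ v : A₆₀ ⟶ (⨁ fun l : Fin 2 => (![A₅, A₁₀] : Fin 2 → AbelianVariety ℂ) l), v = 0) :=
    ⟨fun u => hom_from_pair_eq_zero o5_60.1 o10_60.1 u, fun v => hom_to_pair_eq_zero o5_60.2.1 o10_60.2.1 v⟩
  have b34 : (∀ u : (⨁ fun l : Fin 2 => (![A₁₅, A₃₀] : Fin 2 → AbelianVariety ℂ) l) ⟶ A₂₀, u = 0) ∧ (∀ v : A₂₀ ⟶ (⨁ fun l : Fin 2 => (![A₁₅, A₃₀] : Fin 2 → AbelianVariety ℂ) l), v = 0) :=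
    ⟨fun u => hom_from_pair_eq_zero o15_20.1 o30_20.1 u, fun v => hom_to_pair_eq_zero o15_20.2.1 o30_20.2.1 v⟩
  have b35 : (∀ u : (⨁ fun l : Fin 2 => (![A₁₅, A₃₀] : Fin 2 → AbelianVariety ℂ) l) ⟶ A₆₀, u = 0) ∧ (∀ v : A₆₀ ⟶ (⨁ fun l : Fin 2 => (![A₁₅, A₃₀] : Fin 2 → AbelianVariety ℂ) l), v = 0) :=
    ⟨fun u => hom_from_pair_eq_zero o15_60.1 o30_60.1 u, fun v => hom_to_pair_eq_zero o15_60.2.1 o30_60.2.1 v⟩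
  have b45 : (∀ u : A₂₀ ⟶ A₆₀, u = 0) ∧ (∀ v : A₆₀ ⟶ A₂₀, v = 0) := ⟨o20_60.1, o20_60.2.1⟩
  -- assemble by induction on the list of blocks
  have h5 : ∀ i j : Fin 1, i ≠ j → ∀ f : (![A₆₀] : Fin 1 → AbelianVariety ℂ) i ⟶ (![A₆₀] : Fin 1 → AbelianVariety ℂ) j, f = 0 :=
    hom_eq_zero_of_fin_one
  have h4 := hom_eq_zero_vecCons (X := A₂₀) (F := (![A₆₀] : Fin 1 → AbelianVariety ℂ)) (Fin.cons b45 finZeroElim) h5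
  have h3 := hom_eq_zero_vecCons (X := (⨁ fun l : Fin 2 => (![A₁₅, A₃₀] : Fin 2 → AbelianVariety ℂ) l)) (F := (![A₂₀, A₆₀] : Fin 2 → AbelianVariety ℂ))
    (Fin.cons b34 (Fin.cons b35 finZeroElim)) h4
  have h2 := hom_eq_zero_vecCons (X := (⨁ fun l : Fin 2 => (![A₅, A₁₀] : Fin 2 → AbelianVariety ℂ) l))
    (F := (![(⨁ fun l : Fin 2 => (![A₁₅, A₃₀] : Fin 2 → AbelianVariety ℂ) l), A₂₀, A₆₀] : Fin 3 → AbelianVariety ℂ))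
    (Fin.cons b23 (Fin.cons b24 (Fin.cons b25 finZeroElim))) h3
  have h1 := hom_eq_zero_vecCons (X := (⨁ fun l : Fin 2 => (![A₄, A₁₂] : Fin 2 → AbelianVariety ℂ) l))
    (F := (![(⨁ fun l : Fin 2 => (![A₅, A₁₀] : Fin 2 → AbelianVariety ℂ) l), (⨁ fun l : Fin 2 => (![A₁₅, A₃₀] : Fin 2 → AbelianVariety ℂ) l), A₂₀, A₆₀] : Fin 4 → AbelianVariety ℂ))
    (Fin.cons b12 (Fin.cons b13 (Fin.cons b14 (Fin.cons b15 finZeroElim)))) h2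
  exact hom_eq_zero_vecCons (X := (⨁ fun l : Fin 2 => (![A₃, A₆] : Fin 2 → AbelianVariety ℂ) l))
    (F := (![(⨁ fun l : Fin 2 => (![A₄, A₁₂] : Fin 2 → AbelianVariety ℂ) l), (⨁ fun l : Fin 2 => (![A₅, A₁₀] : Fin 2 → AbelianVariety ℂ) l),
      (⨁ fun l : Fin 2 => (![A₁₅, A₃₀] : Fin 2 → AbelianVariety ℂ) l), A₂₀, A₆₀] : Fin 5 → AbelianVariety ℂ))
    (Fin.cons b01 (Fin.cons b02 (Fin.cons b03 (Fin.cons b04 (Fin.cons b05 finZeroElim))))) h1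

/-- The product of six algebras indexed by `Fin 6` (`∏_{i : Fin 6} T_i ≃ₐ T₀ × (T₁ × (T₂ × (T₃ × (T₄ × T₅))))`). [folklore] -/
private theorem nonempty_pi_fin_six_algEquiv_prod (T : Fin 6 → Type) [∀ i, Ring (T i)] [∀ i, Algebra ℚ (T i)] :
    Nonempty ((∀ i, T i) ≃ₐ[ℚ] T 0 × (T 1 × (T 2 × (T 3 × (T 4 × T 5))))) := by
  refine ⟨AlgEquiv.ofBijective
    ((Pi.evalAlgHom ℚ T 0).prod ((Pi.evalAlgHom ℚ T 1).prod ((Pi.evalAlgHom ℚ T 2).prod ((Pi.evalAlgHom ℚ T 3).prod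
      ((Pi.evalAlgHom ℚ T 4).prod (Pi.evalAlgHom ℚ T 5))))))
    ⟨fun f g h => ?_, fun x => ?_⟩⟩
  · simp only [AlgHom.prod_apply, Pi.evalAlgHom_apply, Prod.mk.injEq] at h
    funext i
    match i with
    | ⟨0, _⟩ => exact h.1
    | ⟨1, _⟩ => exact h.2.1
    | ⟨2, _⟩ => exact h.2.2.1
    | ⟨3, _⟩ => exact h.2.2.2.1
    | ⟨4, _⟩ => exact h.2.2.2.2.1
    | ⟨5, _⟩ => exact h.2.2.2.2.2
  · exact ⟨Fin.cons x.1 (Fin.cons x.2.1 (Fin.cons x.2.2.1 (Fin.cons x.2.2.2.1 (Fin.cons x.2.2.2.2.1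
      (Fin.cons x.2.2.2.2.2 finZeroElim))))), rfl⟩

/-! ## §4 `End⁰(J_{60}) ≅ Mat₂(ℚ(ζ_3)) × Mat₃(ℚ(ζ_4)) × Mat₂(ℚ(ζ_5)) × Mat₂(ℚ(ζ_{15})) × Mat₄(ℚ(√−5)) × Mat₄(F_{60})`, `dim_ℚ = 170`, `dim J_{60} = 29` -/

/-- **GGL THM. 3.0 + LEMMA 14 at the exceptional level `60`:
`End⁰(J_{60}) ≃ₐ[ℚ] Mat₂(ℚ(ζ_3)) × (Mat₃(ℚ(ζ_4)) × (Mat₂(ℚ(ζ_5)) × (Mat₂(ℚ(ζ_{15})) × (Mat₄(ℚ(r₂₀)) × Mat₄(ℚ(r₆₀))))))`**, `r₂₀ = ζ + ζ³ + ζ⁷ + ζ⁹`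
(`r₂₀² = −5`, `F_{20} = ℚ(√−5)`), `r₆₀ = ζ + ζ¹¹ + ζ¹⁹ + ζ²⁹` (`r₆₀⁴ + 15r₆₀² + 45 = 0`, `F_{60}`), on the carrier
`⨁_{Fin 6} ![A₃ ⊕ A₆, A₄ ⊕ A₁₂, A₅ ⊕ A₁₀, A₁₅ ⊕ A₃₀, A₂₀, A₆₀]` for EVERY family of realisations of the lower-half types: the blocks are pairwise
orthogonal (§3), `End⁰` of an orthogonal biproduct is the product (Mumford §19 Cor. 2, tree `AbelianVariety.nonempty_algEquiv_endAlgebra_biproduct_pi`),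
`End⁰(A₃ ⊕ A₆) ≅ Mat₂(ℚ(ζ_3))`, `End⁰(A₄ ⊕ A₁₂) ≅ Mat₃(ℚ(ζ_4))` (F15), `End⁰(A₅ ⊕ A₁₀) ≅ Mat₂(ℚ(ζ_5))`, `End⁰(A₁₅ ⊕ A₃₀) ≅ Mat₂(ℚ(ζ_{15}))` (§2),
`End⁰(A₂₀) ≅ Mat₄(ℚ(r₂₀))`, `End⁰(A₆₀) ≅ Mat₄(ℚ(r₆₀))` (Lemma 14 (3), F9).
[cite: GalleseGoodsonLombardo2024, §3.5 Lemma 14 and the sentence following it; §3 Thm. 3.0 (4)–(6) and last statement; §3.4]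
[cite: MumfordAV1970, §19 Cor. 2 of Thm. 3 and p. 174] [cite: Shimura1998, §5.1 Prop. 3 (proof) and Prop. 6] -/
theorem nonempty_endAlgebra_algEquiv_sixtyJacobian (hΦ₃ : ∀ σ : K₃ →+* ℂ, σ ∈ Φ₃.1 ↔ 2 * (expOf 3 K₃ σ).val < 3)
    (hA₃ : IsCMTypeRealisation Φ₃ A₃ ι₃ θ₃)
    (hΨ₃ : ∀ σ : L₃ →+* ℂ, σ ∈ Ψ₃.1 ↔ 2 * (expOf (2 * 3) L₃ σ).val < 2 * 3) (hA₆ : IsCMTypeRealisation Ψ₃ A₆ ι₆ θ₆)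
    (hΦ₄ : ∀ σ : K₄ →+* ℂ, σ ∈ Φ₄.1 ↔ 2 * (expOf 4 K₄ σ).val < 4) (hA₄ : IsCMTypeRealisation Φ₄ A₄ ι₄ θ₄)
    (hΦ₁₂ : ∀ σ : K₁₂ →+* ℂ, σ ∈ Φ₁₂.1 ↔ 2 * (expOf 12 K₁₂ σ).val < 12) (hA₁₂ : IsCMTypeRealisation Φ₁₂ A₁₂ ι₁₂ θ₁₂)
    (hΦ₅ : ∀ σ : K₅ →+* ℂ, σ ∈ Φ₅.1 ↔ 2 * (expOf 5 K₅ σ).val < 5) (hA₅ : IsCMTypeRealisation Φ₅ A₅ ι₅ θ₅)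
    (hΨ₅ : ∀ σ : L₅ →+* ℂ, σ ∈ Ψ₅.1 ↔ 2 * (expOf (2 * 5) L₅ σ).val < 2 * 5) (hA₁₀ : IsCMTypeRealisation Ψ₅ A₁₀ ι₁₀ θ₁₀)
    (hΦ₁₅ : ∀ σ : K₁₅ →+* ℂ, σ ∈ Φ₁₅.1 ↔ 2 * (expOf 15 K₁₅ σ).val < 15) (hA₁₅ : IsCMTypeRealisation Φ₁₅ A₁₅ ι₁₅ θ₁₅)
    (hΨ₁₅ : ∀ σ : L₁₅ →+* ℂ, σ ∈ Ψ₁₅.1 ↔ 2 * (expOf (2 * 15) L₁₅ σ).val < 2 * 15) (hA₃₀ : IsCMTypeRealisation Ψ₁₅ A₃₀ ι₃₀ θ₃₀)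
    (hΦ₂₀ : ∀ σ : K₂₀ →+* ℂ, σ ∈ Φ₂₀.1 ↔ 2 * (expOf 20 K₂₀ σ).val < 20) (hA₂₀ : IsCMTypeRealisation Φ₂₀ A₂₀ ι₂₀ θ₂₀)
    (hΦ₆₀ : ∀ σ : K₆₀ →+* ℂ, σ ∈ Φ₆₀.1 ↔ 2 * (expOf 60 K₆₀ σ).val < 60) (hA₆₀ : IsCMTypeRealisation Φ₆₀ A₆₀ ι₆₀ θ₆₀) :
    Nonempty ((⨁ fun i : Fin 6 =>
        (![⨁ fun l : Fin 2 => (![A₃, A₆] : Fin 2 → AbelianVariety ℂ) l, ⨁ fun l : Fin 2 => (![A₄, A₁₂] : Fin 2 → AbelianVariety ℂ) l,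
          ⨁ fun l : Fin 2 => (![A₅, A₁₀] : Fin 2 → AbelianVariety ℂ) l, ⨁ fun l : Fin 2 => (![A₁₅, A₃₀] : Fin 2 → AbelianVariety ℂ) l,
          A₂₀, A₆₀] : Fin 6 → AbelianVariety ℂ) i).endAlgebra ≃ₐ[ℚ]
      Matrix (Fin 2) (Fin 2) K₃ × (Matrix (Fin 3) (Fin 3) K₄ × (Matrix (Fin 2) (Fin 2) K₅ × (Matrix (Fin 2) (Fin 2) K₁₅ ×
        (Matrix (Fin 4) (Fin 4) (IntermediateField.adjoin ℚ {zetaOf 20 K₂₀ + zetaOf 20 K₂₀ ^ 3 + zetaOf 20 K₂₀ ^ 7 + zetaOf 20 K₂₀ ^ 9}) ×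
          Matrix (Fin 4) (Fin 4) (IntermediateField.adjoin ℚ {zetaOf 60 K₆₀ + zetaOf 60 K₆₀ ^ 11 + zetaOf 60 K₆₀ ^ 19 + zetaOf 60 K₆₀ ^ 29})))))) := by
  classical
  haveI : NeZero (2 * 5 : ℕ) := ⟨by norm_num⟩
  haveI : NeZero (2 * 15 : ℕ) := ⟨by norm_num⟩
  have hodd5 : Odd 5 := by decide
  have hodd15 : Odd 15 := by decide
  obtain ⟨E, -⟩ := AbelianVariety.nonempty_algEquiv_endAlgebra_biproduct_pi
    (A := fun i : Fin 6 => (![⨁ fun l : Fin 2 => (![A₃, A₆] : Fin 2 → AbelianVariety ℂ) l, ⨁ fun l : Fin 2 => (![A₄, A₁₂] : Fin 2 → AbelianVariety ℂ) l,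
          ⨁ fun l : Fin 2 => (![A₅, A₁₀] : Fin 2 → AbelianVariety ℂ) l, ⨁ fun l : Fin 2 => (![A₁₅, A₃₀] : Fin 2 → AbelianVariety ℂ) l,
          A₂₀, A₆₀] : Fin 6 → AbelianVariety ℂ) i)
    (hom_eq_zero_blocks_sixty hΦ₃ hA₃ hΨ₃ hA₆ hA₄ hΦ₁₂ hA₁₂ hΦ₅ hA₅ hΨ₅ hA₁₀ hΦ₁₅ hA₁₅ hΨ₁₅ hA₃₀ hΦ₂₀ hA₂₀ hΦ₆₀ hA₆₀)
  obtain ⟨P⟩ := nonempty_pi_fin_six_algEquiv_prod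
    (fun i : Fin 6 => ((![⨁ fun l : Fin 2 => (![A₃, A₆] : Fin 2 → AbelianVariety ℂ) l, ⨁ fun l : Fin 2 => (![A₄, A₁₂] : Fin 2 → AbelianVariety ℂ) l,
          ⨁ fun l : Fin 2 => (![A₅, A₁₀] : Fin 2 → AbelianVariety ℂ) l, ⨁ fun l : Fin 2 => (![A₁₅, A₃₀] : Fin 2 → AbelianVariety ℂ) l,
          A₂₀, A₆₀] : Fin 6 → AbelianVariety ℂ) i).endAlgebra)
  obtain ⟨e₀⟩ := nonempty_endAlgebra_three_six_algEquiv_matrix hΦ₃ hA₃ hΨ₃ hA₆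
  obtain ⟨e₁⟩ := nonempty_endAlgebra_four_twelve_algEquiv_matrix hΦ₄ hA₄ hΦ₁₂ hA₁₂
  obtain ⟨e₂⟩ := nonempty_endAlgebra_odd_twiceOdd_algEquiv_matrix hodd5 (by norm_num) hΦ₅ hA₅ hΨ₅ hA₁₀
  obtain ⟨e₃⟩ := nonempty_endAlgebra_odd_twiceOdd_algEquiv_matrix hodd15 (by norm_num) hΦ₁₅ hA₁₅ hΨ₁₅ hA₃₀
  obtain ⟨-, -, -, ⟨e₄⟩, -⟩ := nonempty_matrix_four_algEquiv_endAlgebra_twenty Φ₂₀ hΦ₂₀ hA₂₀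
  obtain ⟨-, -, -, ⟨e₅⟩, -⟩ := nonempty_matrix_four_algEquiv_endAlgebra_sixty Φ₆₀ hΦ₆₀ hA₆₀
  exact ⟨(E.trans P).trans (AlgEquiv.prodCongr e₀ (AlgEquiv.prodCongr e₁ (AlgEquiv.prodCongr e₂ (AlgEquiv.prodCongr e₃
    (AlgEquiv.prodCongr e₄.symm e₅.symm)))))⟩

/-- **`dim_ℚ End⁰(J_{60}) = 170` and `dim J_{60} = 29 = g(C_{60})`** (`8 + 18 + 16 + 32 + 32 + 64`; `2 + 3 + 4 + 8 + 4 + 8`).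
[cite: GalleseGoodsonLombardo2024, §3 Thm. 3.0 and §3.5 Lemma 14] [cite: MumfordAV1970, §19 Cor. 2 of Thm. 3] -/
theorem finrank_endAlgebra_sixtyJacobian (hΦ₃ : ∀ σ : K₃ →+* ℂ, σ ∈ Φ₃.1 ↔ 2 * (expOf 3 K₃ σ).val < 3)
    (hA₃ : IsCMTypeRealisation Φ₃ A₃ ι₃ θ₃)
    (hΨ₃ : ∀ σ : L₃ →+* ℂ, σ ∈ Ψ₃.1 ↔ 2 * (expOf (2 * 3) L₃ σ).val < 2 * 3) (hA₆ : IsCMTypeRealisation Ψ₃ A₆ ι₆ θ₆)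
    (hΦ₄ : ∀ σ : K₄ →+* ℂ, σ ∈ Φ₄.1 ↔ 2 * (expOf 4 K₄ σ).val < 4) (hA₄ : IsCMTypeRealisation Φ₄ A₄ ι₄ θ₄)
    (hΦ₁₂ : ∀ σ : K₁₂ →+* ℂ, σ ∈ Φ₁₂.1 ↔ 2 * (expOf 12 K₁₂ σ).val < 12) (hA₁₂ : IsCMTypeRealisation Φ₁₂ A₁₂ ι₁₂ θ₁₂)
    (hΦ₅ : ∀ σ : K₅ →+* ℂ, σ ∈ Φ₅.1 ↔ 2 * (expOf 5 K₅ σ).val < 5) (hA₅ : IsCMTypeRealisation Φ₅ A₅ ι₅ θ₅)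
    (hΨ₅ : ∀ σ : L₅ →+* ℂ, σ ∈ Ψ₅.1 ↔ 2 * (expOf (2 * 5) L₅ σ).val < 2 * 5) (hA₁₀ : IsCMTypeRealisation Ψ₅ A₁₀ ι₁₀ θ₁₀)
    (hΦ₁₅ : ∀ σ : K₁₅ →+* ℂ, σ ∈ Φ₁₅.1 ↔ 2 * (expOf 15 K₁₅ σ).val < 15) (hA₁₅ : IsCMTypeRealisation Φ₁₅ A₁₅ ι₁₅ θ₁₅)
    (hΨ₁₅ : ∀ σ : L₁₅ →+* ℂ, σ ∈ Ψ₁₅.1 ↔ 2 * (expOf (2 * 15) L₁₅ σ).val < 2 * 15) (hA₃₀ : IsCMTypeRealisation Ψ₁₅ A₃₀ ι₃₀ θ₃₀)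
    (hΦ₂₀ : ∀ σ : K₂₀ →+* ℂ, σ ∈ Φ₂₀.1 ↔ 2 * (expOf 20 K₂₀ σ).val < 20) (hA₂₀ : IsCMTypeRealisation Φ₂₀ A₂₀ ι₂₀ θ₂₀)
    (hΦ₆₀ : ∀ σ : K₆₀ →+* ℂ, σ ∈ Φ₆₀.1 ↔ 2 * (expOf 60 K₆₀ σ).val < 60) (hA₆₀ : IsCMTypeRealisation Φ₆₀ A₆₀ ι₆₀ θ₆₀) :
    finrank ℚ (⨁ fun i : Fin 6 =>
        (![⨁ fun l : Fin 2 => (![A₃, A₆] : Fin 2 → AbelianVariety ℂ) l, ⨁ fun l : Fin 2 => (![A₄, A₁₂] : Fin 2 → AbelianVariety ℂ) l,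
          ⨁ fun l : Fin 2 => (![A₅, A₁₀] : Fin 2 → AbelianVariety ℂ) l, ⨁ fun l : Fin 2 => (![A₁₅, A₃₀] : Fin 2 → AbelianVariety ℂ) l,
          A₂₀, A₆₀] : Fin 6 → AbelianVariety ℂ) i).endAlgebra = 170 ∧
    (⨁ fun i : Fin 6 =>
        (![⨁ fun l : Fin 2 => (![A₃, A₆] : Fin 2 → AbelianVariety ℂ) l, ⨁ fun l : Fin 2 => (![A₄, A₁₂] : Fin 2 → AbelianVariety ℂ) l,
          ⨁ fun l : Fin 2 => (![A₅, A₁₀] : Fin 2 → AbelianVariety ℂ) l, ⨁ fun l : Fin 2 => (![A₁₅, A₃₀] : Fin 2 → AbelianVariety ℂ) l,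
          A₂₀, A₆₀] : Fin 6 → AbelianVariety ℂ) i).dim = 29 := by
  classical
  haveI : NeZero (2 * 3 : ℕ) := ⟨by norm_num⟩
  haveI : NeZero (2 * 5 : ℕ) := ⟨by norm_num⟩
  haveI : NeZero (2 * 15 : ℕ) := ⟨by norm_num⟩
  haveI : NeZero (12 : ℕ) := ⟨by norm_num⟩
  have hodd3 : Odd 3 := by decide
  have hodd5 : Odd 5 := by decide
  have hodd15 : Odd 15 := by decide
  obtain ⟨hd₂₀, -, hF₂₀, -⟩ := nonempty_matrix_four_algEquiv_endAlgebra_twenty Φ₂₀ hΦ₂₀ hA₂₀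
  obtain ⟨hd₆₀, -, hF₆₀, -⟩ := nonempty_matrix_four_algEquiv_endAlgebra_sixty Φ₆₀ hΦ₆₀ hA₆₀
  have hK₃ : finrank ℚ K₃ = 2 := by rw [finrank_eq_totient 3 K₃]; decide +kernel
  have hK₄ : finrank ℚ K₄ = 2 := by rw [finrank_eq_totient 4 K₄]; decide +kernel
  have hK₅ : finrank ℚ K₅ = 4 := by rw [finrank_eq_totient 5 K₅]; decide +kernel
  have hK₁₅ : finrank ℚ K₁₅ = 8 := by rw [finrank_eq_totient 15 K₁₅]; decide +kernel
  refine ⟨?_, ?_⟩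
  · obtain ⟨e⟩ := nonempty_endAlgebra_algEquiv_sixtyJacobian hΦ₃ hA₃ hΨ₃ hA₆ hΦ₄ hA₄ hΦ₁₂ hA₁₂ hΦ₅ hA₅ hΨ₅ hA₁₀ hΦ₁₅ hA₁₅ hΨ₁₅ hA₃₀ hΦ₂₀ hA₂₀ hΦ₆₀ hA₆₀
    haveI : FiniteDimensional ℚ (IntermediateField.adjoin ℚ {zetaOf 20 K₂₀ + zetaOf 20 K₂₀ ^ 3 + zetaOf 20 K₂₀ ^ 7 + zetaOf 20 K₂₀ ^ 9}) := IntermediateField.finiteDimensional_left _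
    haveI : FiniteDimensional ℚ (IntermediateField.adjoin ℚ {zetaOf 60 K₆₀ + zetaOf 60 K₆₀ ^ 11 + zetaOf 60 K₆₀ ^ 19 + zetaOf 60 K₆₀ ^ 29}) := IntermediateField.finiteDimensional_left _
    -- finiteness and freeness of the six factors and of the nested products, bottom-up (keeps instance search shallow)
    haveI : Module.Finite ℚ (Matrix (Fin 4) (Fin 4) (IntermediateField.adjoin ℚ {zetaOf 60 K₆₀ + zetaOf 60 K₆₀ ^ 11 + zetaOf 60 K₆₀ ^ 19 + zetaOf 60 K₆₀ ^ 29})) := Module.Finite.matrix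
    haveI : Module.Finite ℚ (Matrix (Fin 4) (Fin 4) (IntermediateField.adjoin ℚ {zetaOf 20 K₂₀ + zetaOf 20 K₂₀ ^ 3 + zetaOf 20 K₂₀ ^ 7 + zetaOf 20 K₂₀ ^ 9})) := Module.Finite.matrix
    haveI : Module.Finite ℚ (Matrix (Fin 2) (Fin 2) K₁₅) := Module.Finite.matrix
    haveI : Module.Finite ℚ (Matrix (Fin 2) (Fin 2) K₅) := Module.Finite.matrix
    haveI : Module.Finite ℚ (Matrix (Fin 3) (Fin 3) K₄) := Module.Finite.matrix
    haveI : Module.Finite ℚ (Matrix (Fin 2) (Fin 2) K₃) := Module.Finite.matrix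
    haveI : Module.Free ℚ (Matrix (Fin 4) (Fin 4) (IntermediateField.adjoin ℚ {zetaOf 60 K₆₀ + zetaOf 60 K₆₀ ^ 11 + zetaOf 60 K₆₀ ^ 19 + zetaOf 60 K₆₀ ^ 29})) := inferInstance
    haveI : Module.Free ℚ (Matrix (Fin 4) (Fin 4) (IntermediateField.adjoin ℚ {zetaOf 20 K₂₀ + zetaOf 20 K₂₀ ^ 3 + zetaOf 20 K₂₀ ^ 7 + zetaOf 20 K₂₀ ^ 9})) := inferInstance
    haveI : Module.Free ℚ (Matrix (Fin 2) (Fin 2) K₁₅) := inferInstance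
    haveI : Module.Free ℚ (Matrix (Fin 2) (Fin 2) K₅) := inferInstance
    haveI : Module.Free ℚ (Matrix (Fin 3) (Fin 3) K₄) := inferInstance
    haveI : Module.Free ℚ (Matrix (Fin 2) (Fin 2) K₃) := inferInstance
    haveI : Module.Finite ℚ (Matrix (Fin 4) (Fin 4) (IntermediateField.adjoin ℚ {zetaOf 20 K₂₀ + zetaOf 20 K₂₀ ^ 3 + zetaOf 20 K₂₀ ^ 7 + zetaOf 20 K₂₀ ^ 9}) ×
        Matrix (Fin 4) (Fin 4) (IntermediateField.adjoin ℚ {zetaOf 60 K₆₀ + zetaOf 60 K₆₀ ^ 11 + zetaOf 60 K₆₀ ^ 19 + zetaOf 60 K₆₀ ^ 29})) := inferInstance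
    haveI : Module.Free ℚ (Matrix (Fin 4) (Fin 4) (IntermediateField.adjoin ℚ {zetaOf 20 K₂₀ + zetaOf 20 K₂₀ ^ 3 + zetaOf 20 K₂₀ ^ 7 + zetaOf 20 K₂₀ ^ 9}) ×
        Matrix (Fin 4) (Fin 4) (IntermediateField.adjoin ℚ {zetaOf 60 K₆₀ + zetaOf 60 K₆₀ ^ 11 + zetaOf 60 K₆₀ ^ 19 + zetaOf 60 K₆₀ ^ 29})) := inferInstance
    haveI : Module.Finite ℚ (Matrix (Fin 2) (Fin 2) K₁₅ × (Matrix (Fin 4) (Fin 4) (IntermediateField.adjoin ℚ {zetaOf 20 K₂₀ + zetaOf 20 K₂₀ ^ 3 + zetaOf 20 K₂₀ ^ 7 + zetaOf 20 K₂₀ ^ 9}) ×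
        Matrix (Fin 4) (Fin 4) (IntermediateField.adjoin ℚ {zetaOf 60 K₆₀ + zetaOf 60 K₆₀ ^ 11 + zetaOf 60 K₆₀ ^ 19 + zetaOf 60 K₆₀ ^ 29}))) := inferInstance
    haveI : Module.Free ℚ (Matrix (Fin 2) (Fin 2) K₁₅ × (Matrix (Fin 4) (Fin 4) (IntermediateField.adjoin ℚ {zetaOf 20 K₂₀ + zetaOf 20 K₂₀ ^ 3 + zetaOf 20 K₂₀ ^ 7 + zetaOf 20 K₂₀ ^ 9}) ×
        Matrix (Fin 4) (Fin 4) (IntermediateField.adjoin ℚ {zetaOf 60 K₆₀ + zetaOf 60 K₆₀ ^ 11 + zetaOf 60 K₆₀ ^ 19 + zetaOf 60 K₆₀ ^ 29}))) := inferInstance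
    haveI : Module.Finite ℚ (Matrix (Fin 2) (Fin 2) K₅ × (Matrix (Fin 2) (Fin 2) K₁₅ × (Matrix (Fin 4) (Fin 4) (IntermediateField.adjoin ℚ {zetaOf 20 K₂₀ + zetaOf 20 K₂₀ ^ 3 + zetaOf 20 K₂₀ ^ 7 + zetaOf 20 K₂₀ ^ 9}) ×
        Matrix (Fin 4) (Fin 4) (IntermediateField.adjoin ℚ {zetaOf 60 K₆₀ + zetaOf 60 K₆₀ ^ 11 + zetaOf 60 K₆₀ ^ 19 + zetaOf 60 K₆₀ ^ 29})))) := inferInstance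
    haveI : Module.Free ℚ (Matrix (Fin 2) (Fin 2) K₅ × (Matrix (Fin 2) (Fin 2) K₁₅ × (Matrix (Fin 4) (Fin 4) (IntermediateField.adjoin ℚ {zetaOf 20 K₂₀ + zetaOf 20 K₂₀ ^ 3 + zetaOf 20 K₂₀ ^ 7 + zetaOf 20 K₂₀ ^ 9}) ×
        Matrix (Fin 4) (Fin 4) (IntermediateField.adjoin ℚ {zetaOf 60 K₆₀ + zetaOf 60 K₆₀ ^ 11 + zetaOf 60 K₆₀ ^ 19 + zetaOf 60 K₆₀ ^ 29})))) := inferInstance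
    haveI : Module.Finite ℚ (Matrix (Fin 3) (Fin 3) K₄ × (Matrix (Fin 2) (Fin 2) K₅ × (Matrix (Fin 2) (Fin 2) K₁₅ ×
        (Matrix (Fin 4) (Fin 4) (IntermediateField.adjoin ℚ {zetaOf 20 K₂₀ + zetaOf 20 K₂₀ ^ 3 + zetaOf 20 K₂₀ ^ 7 + zetaOf 20 K₂₀ ^ 9}) × Matrix (Fin 4) (Fin 4) (IntermediateField.adjoin ℚ {zetaOf 60 K₆₀ + zetaOf 60 K₆₀ ^ 11 + zetaOf 60 K₆₀ ^ 19 + zetaOf 60 K₆₀ ^ 29}))))) := inferInstance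
    haveI : Module.Free ℚ (Matrix (Fin 3) (Fin 3) K₄ × (Matrix (Fin 2) (Fin 2) K₅ × (Matrix (Fin 2) (Fin 2) K₁₅ ×
        (Matrix (Fin 4) (Fin 4) (IntermediateField.adjoin ℚ {zetaOf 20 K₂₀ + zetaOf 20 K₂₀ ^ 3 + zetaOf 20 K₂₀ ^ 7 + zetaOf 20 K₂₀ ^ 9}) × Matrix (Fin 4) (Fin 4) (IntermediateField.adjoin ℚ {zetaOf 60 K₆₀ + zetaOf 60 K₆₀ ^ 11 + zetaOf 60 K₆₀ ^ 19 + zetaOf 60 K₆₀ ^ 29}))))) := inferInstance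
    rw [e.toLinearEquiv.finrank_eq, Module.finrank_prod, Module.finrank_prod, Module.finrank_prod, Module.finrank_prod, Module.finrank_prod,
      Module.finrank_matrix, Module.finrank_matrix, Module.finrank_matrix, Module.finrank_matrix, Module.finrank_matrix, Module.finrank_matrix]
    simp only [Fintype.card_fin]
    rw [hK₃, hK₄, hK₅, hK₁₅, hF₂₀, hF₆₀]
  · have h36 := dim_pair_odd_twiceOdd hodd3 le_rfl hΦ₃ hA₃ hΨ₃ hA₆
    have h510 := dim_pair_odd_twiceOdd hodd5 (by norm_num) hΦ₅ hA₅ hΨ₅ hA₁₀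
    have h1530 := dim_pair_odd_twiceOdd hodd15 (by norm_num) hΦ₁₅ hA₁₅ hΨ₁₅ hA₃₀
    rw [show Nat.totient 3 = 2 by decide +kernel] at h36
    rw [show Nat.totient 5 = 4 by decide +kernel] at h510
    rw [show Nat.totient 15 = 8 by decide +kernel] at h1530
    have hd₄ : A₄.dim = 1 := by
      have h : A₄.dim = finrank ℚ K₄ / 2 := Motives.schemeDim_eq_holds hA₄.1
      rw [hK₄] at h
      simpa using h
    have hd₁₂ : A₁₂.dim = 2 := by
      have h : A₁₂.dim = finrank ℚ K₁₂ / 2 := Motives.schemeDim_eq_holds hA₁₂.1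
      rw [finrank_eq_totient 12 K₁₂, show Nat.totient 12 = 4 by decide +kernel] at h
      simpa using h
    have h412 : (⨁ fun l : Fin 2 => (![A₄, A₁₂] : Fin 2 → AbelianVariety ℂ) l).dim = 3 := by
      rw [AbelianVariety.dim_biproduct, Fin.sum_univ_two]
      simp only [Matrix.cons_val_zero, Matrix.cons_val_one]
      omega
    rw [AbelianVariety.dim_biproduct, Fin.sum_univ_six]
    show (⨁ fun l : Fin 2 => (![A₃, A₆] : Fin 2 → AbelianVariety ℂ) l).dim +
        (⨁ fun l : Fin 2 => (![A₄, A₁₂] : Fin 2 → AbelianVariety ℂ) l).dim +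
        (⨁ fun l : Fin 2 => (![A₅, A₁₀] : Fin 2 → AbelianVariety ℂ) l).dim +
        (⨁ fun l : Fin 2 => (![A₁₅, A₃₀] : Fin 2 → AbelianVariety ℂ) l).dim + A₂₀.dim + A₆₀.dim = 29
    omega

end SixtyJacobian

end HyperellipticJacobian

end Literature.AlgebraicGeometry.ComplexMultiplication

end
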